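import Mathlib.Combinatorics.SimpleGraph.Maps
import Mathlib.Data.Fintype.Card
import Mathlib.Data.Finset.Card
import Literature.Combinatorics.SimpleGraph.ColourRefinement
import HarnessLib

/-!
# Sections of a vertex colouring (Goldberg 1983; Corneil–Goldberg 1984) and the half-cell lemma

The combinatorial device behind the singly exponential (`2^{O(n)}`) graph canonization of
Corneil and Goldberg [CorneilGoldberg1984], in the self-contained exposition of Laubner's thesis
[Laubner2011, Ch. 3] (which extends it to edge-coloured directed graphs; we vendor the undirected
simple-graph case the tree needs — `TODO(general form)`: binary relational structures).

* `IsSection G ρ H` ([Laubner2011, Def. 3.3.1]; sections of undirected graphs are due to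
  [Goldberg1983]): `H ⊆ V` is a SECTION of the colouring `ρ` if, for every pair `(u, v)` CROSSING
  `H` (exactly one of `u`, `v` in `H`), adjacency is determined by the colour-and-side classes of
  `u` and `v`. `∅` and `univ` are the trivial sections; complements of sections are sections
  (`IsSection.compl`); sections are label-invariant (`isSection_comap_iff`) and depend only on
  the partition (`IsSection.congr_ker`). `HasSection G ρ`: a non-trivial section exists.
* **The half-cell lemma** ([Laubner2011, Lemma 3.5.1], after [CorneilGoldberg1984]):
  `exists_half_cell_of_not_hasSection` — if `ρ` is stable (equitable, `IsEquitable`), has NO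
  non-trivial section, `x` lies in a non-singleton cell of `ρ`, and `ρ'` is a stable refinement of
  `ρ` in which `x` is a singleton cell and which is not discrete, then some cell `Y` of `ρ'` and
  the cell `X ⊇ Y` of `ρ` satisfy `1 < |Y|` and `2 |Y| ≤ |X|`. (Laubner's statement omits "not
  discrete", which the proof needs and the application has.) This is the engine of the
  `2^{O(n)}` bound on the Corneil–Goldberg recursion tree ([Laubner2011, Prop. 3.5.2]).

## References

* D. G. Corneil, M. K. Goldberg, *A non-factorial algorithm for canonical numbering of a graph*,
  J. Algorithms 5 (1984) 345–362, doi:10.1016/0196-6774(84)90015-4. [CorneilGoldberg1984]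
* B. Laubner, *The structure of graphs and new logics for the characterization of Polynomial
  Time*, PhD thesis, HU Berlin 2011, doi:10.18452/16335, Def. 3.2.7, Def. 3.3.1, Lemma 3.5.1;
  read pp. 41–53. [Laubner2011]
* M. K. Goldberg, *A nonfactorial algorithm for testing isomorphism of two graphs*, Discrete
  Appl. Math. 6 (1983) 229–236 (sections of undirected graphs).
-/

namespace Literature.Combinatorics.SimpleGraph

open _root_.SimpleGraph Finset

universe u

variable {V : Type u} (G : _root_.SimpleGraph V)

/-! ## Sections -/

/-- `H` is a **section** of the colouring `ρ` in `G`: for all pairs `(u, v)` crossing `H` (exactly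
one of `u`, `v` lies in `H`), whether `u ~ v` depends only on the colours of `u`, `v` and on the
sides of `H` they lie on. [cite: Laubner2011, Def. 3.3.1] -/
def IsSection {κ : Type*} (ρ : V → κ) (H : Set V) : Prop :=
  ∀ ⦃u u' v v' : V⦄, ρ u = ρ u' → ρ v = ρ v' → (u ∈ H ↔ u' ∈ H) → (v ∈ H ↔ v' ∈ H) →
    ¬ (u ∈ H ↔ v ∈ H) → (G.Adj u v ↔ G.Adj u' v')

/-- `ρ` **has a (non-trivial) section**: some `H ≠ ∅, univ` is a section. [cite: Laubner2011, Def. 3.3.1] -/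
def HasSection {κ : Type*} (ρ : V → κ) : Prop :=
  ∃ H : Set V, H.Nonempty ∧ Hᶜ.Nonempty ∧ IsSection G ρ H

variable {G}

/-- The empty set is a (trivial) section. [cite: Laubner2011, Def. 3.3.1] -/
theorem isSection_empty {κ : Type*} (ρ : V → κ) : IsSection G ρ ∅ :=
  fun u _ v _ _ _ _ _ h => absurd (iff_of_false (Set.notMem_empty u) (Set.notMem_empty v)) h

/-- The whole vertex set is a (trivial) section. [cite: Laubner2011, Def. 3.3.1] -/
theorem isSection_univ {κ : Type*} (ρ : V → κ) : IsSection G ρ Set.univ :=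
  fun u _ v _ _ _ _ _ h => absurd (iff_of_true (Set.mem_univ u) (Set.mem_univ v)) h

/-- **Complements of sections are sections.** [cite: Laubner2011, §3.3.1] -/
theorem IsSection.compl {κ : Type*} {ρ : V → κ} {H : Set V} (h : IsSection G ρ H) : IsSection G ρ Hᶜ := by
  intro u u' v v' hu hv huu' hvv' hcross
  simp only [Set.mem_compl_iff, not_iff_not] at huu' hvv'
  exact h hu hv huu' hvv' fun h' => hcross (by simpa only [Set.mem_compl_iff] using not_congr h')

/-- Hence `HasSection` may be witnessed by a section or its complement. [folklore] -/
theorem HasSection.of_compl {κ : Type*} {ρ : V → κ} {H : Set V} (h₁ : H.Nonempty) (h₂ : Hᶜ.Nonempty)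
    (h : IsSection G ρ Hᶜ) : HasSection G ρ :=
  ⟨H, h₁, h₂, by simpa using h.compl⟩

/-- Sections depend only on the partition (the kernel of the colouring). [folklore] -/
theorem IsSection.congr_ker {κ κ' : Type*} {ρ : V → κ} {ρ' : V → κ'} {H : Set V} (h : IsSection G ρ H)
    (hk : ∀ u v : V, ρ u = ρ v ↔ ρ' u = ρ' v) : IsSection G ρ' H :=
  fun _ _ _ _ hu hv => h ((hk _ _).2 hu) ((hk _ _).2 hv)

/-- `HasSection` depends only on the partition. [folklore] -/
theorem hasSection_congr_ker {κ κ' : Type*} {ρ : V → κ} {ρ' : V → κ'}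
    (hk : ∀ u v : V, ρ u = ρ v ↔ ρ' u = ρ' v) : HasSection G ρ ↔ HasSection G ρ' :=
  ⟨fun ⟨H, h₁, h₂, h⟩ => ⟨H, h₁, h₂, h.congr_ker hk⟩,
    fun ⟨H, h₁, h₂, h⟩ => ⟨H, h₁, h₂, h.congr_ker fun u v => (hk u v).symm⟩⟩

/-- **Sections are label-invariant**: along a relabelling `e : W ≃ V`, `e ⁻¹' H` is a section of
`ρ ∘ e` in `G.comap e` iff `H` is a section of `ρ` in `G`. [cite: Laubner2011, §3.3] -/
theorem isSection_comap_iff {W : Type*} {κ : Type*} (ρ : V → κ) (H : Set V) (e : W ≃ V) :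
    IsSection (G.comap e) (ρ ∘ e) (e ⁻¹' H) ↔ IsSection G ρ H := by
  constructor
  · intro h u u' v v' hu hv huu' hvv' hcross
    have := @h (e.symm u) (e.symm u') (e.symm v) (e.symm v') (by simpa using hu) (by simpa using hv)
      (by simpa using huu') (by simpa using hvv') (by simpa using hcross)
    simpa [SimpleGraph.comap_adj] using this
  · intro h u u' v v' hu hv huu' hvv' hcross
    simpa [SimpleGraph.comap_adj] using @h (e u) (e u') (e v) (e v') hu hv huu' hvv' hcross

/-- **`HasSection` is label-invariant.** [cite: Laubner2011, §3.3] -/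
theorem hasSection_comap_iff {W : Type*} {κ : Type*} (ρ : V → κ) (e : W ≃ V) :
    HasSection (G.comap e) (ρ ∘ e) ↔ HasSection G ρ := by
  constructor
  · rintro ⟨H, h₁, h₂, h⟩
    refine ⟨e.symm ⁻¹' H, ?_, ?_, ?_⟩
    · obtain ⟨w, hw⟩ := h₁; exact ⟨e w, by simpa using hw⟩
    · obtain ⟨w, hw⟩ := h₂; exact ⟨e w, by simpa using hw⟩
    · rw [← isSection_comap_iff (G := G) ρ _ e]
      simpa [Set.preimage_preimage] using h
  · rintro ⟨H, h₁, h₂, h⟩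
    refine ⟨e ⁻¹' H, ?_, ?_, (isSection_comap_iff ρ H e).2 h⟩
    · obtain ⟨v, hv⟩ := h₁; exact ⟨e.symm v, by simpa using hv⟩
    · obtain ⟨v, hv⟩ := h₂; exact ⟨e.symm v, by simpa using hv⟩

/-! ## The half-cell lemma -/

/-- Counting with a finset (bridge from the `Nat.card` of `IsEquitable`). [folklore] -/
private theorem natCard_subtype [Fintype V] (p : V → Prop) [DecidablePred p] :
    Nat.card {w : V // p w} = (univ.filter p).card := by
  rw [Nat.card_eq_fintype_card, Fintype.card_subtype]

section HalfCell

variable [Fintype V] [DecidableEq V] [DecidableRel G.Adj]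

omit [DecidableEq V] in
/-- A singleton cell is uniformly adjacent to every cell of an equitable colouring: if `u` is
alone in its `ρ'`-cell and `ρ' v = ρ' w`, then `u ~ v ↔ u ~ w`. [cite: Laubner2011, proof of Lemma 3.5.1] -/
theorem IsEquitable.adj_iff_of_singleton {κ' : Type*} [DecidableEq κ'] {ρ' : V → κ'} (hρ' : IsEquitable G ρ')
    {u v w : V} (hu : ∀ y, ρ' y = ρ' u → y = u) (hvw : ρ' v = ρ' w) : G.Adj u v ↔ G.Adj u w := by
  have key : ∀ a : V, Nat.card {z : V // G.Adj a z ∧ ρ' z = ρ' u} = if G.Adj a u then 1 else 0 := by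
    intro a
    rw [natCard_subtype]
    have : (univ.filter fun z => G.Adj a z ∧ ρ' z = ρ' u) = if G.Adj a u then {u} else ∅ := by
      ext z
      simp only [mem_filter, mem_univ, true_and]
      constructor
      · rintro ⟨haz, hz⟩
        obtain rfl := hu z hz
        rw [if_pos haz]; exact mem_singleton_self _
      · intro hz
        split_ifs at hz with hau
        · rw [mem_singleton] at hz; subst hz; exact ⟨hau, rfl⟩
        · exact absurd hz (notMem_empty _)
    rw [this]; split_ifs <;> simp
  have h := hρ' v w hvw (ρ' u)
  rw [key, key] at h
  rw [G.adj_comm u v, G.adj_comm u w]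
  by_cases h₁ : G.Adj v u <;> by_cases h₂ : G.Adj w u
  · exact iff_of_true h₁ h₂
  · rw [if_pos h₁, if_neg h₂] at h
    exact absurd h one_ne_zero
  · rw [if_neg h₁, if_pos h₂] at h
    exact absurd h.symm one_ne_zero
  · exact iff_of_false h₁ h₂

/-- **The half-cell lemma** ([Laubner2011, Lemma 3.5.1], after [CorneilGoldberg1984]). Let `ρ` be
an equitable colouring of `G` WITHOUT a non-trivial section, `x` a vertex in a non-singleton cell
of `ρ`, and `ρ'` an equitable refinement of `ρ` in which `x` is a singleton cell and which is not
discrete. Then some cell `Y = {w | ρ' w = ρ' v}` of `ρ'` has `1 < |Y|` and `2 |Y| ≤ |X|` for the cell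
`X = {w | ρ w = ρ v} ⊇ Y` of `ρ`. [cite: Laubner2011, Lemma 3.5.1] [cite: CorneilGoldberg1984, §3] -/
theorem exists_half_cell_of_not_hasSection {κ κ' : Type*} [DecidableEq κ] [DecidableEq κ']
    {ρ : V → κ} {ρ' : V → κ'} (hρ : IsEquitable G ρ) (hρ' : IsEquitable G ρ')
    (href : ∀ u v : V, ρ' u = ρ' v → ρ u = ρ v) (hns : ¬ HasSection G ρ)
    {x : V} (hx : ∃ y, y ≠ x ∧ ρ y = ρ x) (hx' : ∀ y, ρ' y = ρ' x → y = x)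
    (hnt : ∃ u v : V, u ≠ v ∧ ρ' u = ρ' v) :
    ∃ v : V, 1 < (univ.filter fun w => ρ' w = ρ' v).card ∧
      2 * (univ.filter fun w => ρ' w = ρ' v).card ≤ (univ.filter fun w => ρ w = ρ v).card := by
  -- cells
  set Y : V → Finset V := fun v => univ.filter fun w => ρ' w = ρ' v with hYdef
  set X : V → Finset V := fun v => univ.filter fun w => ρ w = ρ v with hXdef
  have hYX : ∀ v, Y v ⊆ X v := fun v w hw => by
    simp only [hYdef, hXdef, mem_filter, mem_univ, true_and] at hw ⊢; exact href _ _ hw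
  have hXeq : ∀ {v v'}, ρ v = ρ v' → X v = X v' := fun h => by simp only [hXdef, h]
  have hYeq : ∀ {v v'}, ρ' v = ρ' v' → Y v = Y v' := fun h => by simp only [hYdef, h]
  -- `1 < |Y v|` iff `v` is not a `ρ'`-singleton; `Big v` iff `X v` is not a singleton
  have one_lt_Y : ∀ {v}, (∃ w, w ≠ v ∧ ρ' w = ρ' v) → 1 < (Y v).card := fun {v} ⟨w, hwv, hw⟩ =>
    Finset.one_lt_card.2 ⟨w, by simpa [hYdef] using hw, v, by simp [hYdef], hwv⟩
  have sing_of_Y : ∀ {v}, ¬ 1 < (Y v).card → ∀ w, ρ' w = ρ' v → w = v := fun h w hw => by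
    by_contra hne; exact h (one_lt_Y ⟨w, hne, hw⟩)
  by_contra hcon
  have hcon' : ∀ v, 1 < (Y v).card → (X v).card < 2 * (Y v).card := fun v hv => by
    by_contra h
    exact hcon ⟨v, hv, not_lt.1 h⟩
  -- (a) within a `ρ`-cell there is at most one non-singleton `ρ'`-cell
  have huniq : ∀ {v v'}, ρ v = ρ v' → 1 < (Y v).card → 1 < (Y v').card → ρ' v = ρ' v' := by
    intro v v' hvv' hv hv'
    by_contra hne
    have hdisj : Disjoint (Y v) (Y v') := by
      rw [Finset.disjoint_left]
      intro w hw hw'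
      simp only [hYdef, mem_filter, mem_univ, true_and] at hw hw'
      exact hne (hw.symm.trans hw')
    have hsub : Y v ∪ Y v' ⊆ X v := union_subset (hYX v) (hXeq hvv' ▸ hYX v')
    have := card_le_card hsub
    rw [card_union_of_disjoint hdisj] at this
    have h₁ := hcon' v hv
    have h₂ := hcon' v' hv'
    have hXc : (X v').card = (X v).card := by rw [hXeq hvv']
    omega
  -- the set `Z` of `ρ'`-singletons lying in non-singleton `ρ`-cells
  let Z : Set V := {u | (∀ w, ρ' w = ρ' u → w = u) ∧ ∃ y, y ≠ u ∧ ρ y = ρ u}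
  have hxZ : x ∈ Z := ⟨hx', hx⟩
  have hZc : Zᶜ.Nonempty := by
    obtain ⟨u₀, v₀, hne, huv⟩ := hnt
    exact ⟨v₀, fun h => hne (h.1 u₀ huv)⟩
  -- the key property: adjacency across `Z` is determined by colours
  have key : ∀ u u' v v' : V, ρ u = ρ u' → ρ v = ρ v' → u ∈ Z → u' ∈ Z → v ∉ Z → v' ∉ Z →
      (G.Adj u v ↔ G.Adj u' v') := by
    intro u u' v v' hu hv huZ hu'Z hvZ hv'Z
    by_cases hbig : ∃ y, y ≠ v ∧ ρ y = ρ v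
    · -- `v` lies in a non-singleton `ρ`-cell, hence (not being in `Z`) in a non-singleton `ρ'`-cell
      have hv1 : 1 < (Y v).card := by
        by_contra h
        exact hvZ ⟨sing_of_Y h, hbig⟩
      have hv'1 : 1 < (Y v').card := by
        by_contra h
        refine hv'Z ⟨sing_of_Y h, ?_⟩
        obtain ⟨y, hyv, hy⟩ := hbig
        by_cases hyv' : y = v'
        · exact ⟨v, fun h' => hyv (hyv'.trans h'.symm), hv⟩
        · exact ⟨y, hyv', hy.trans hv⟩
      have hρ'vv' : ρ' v = ρ' v' := huniq hv hv1 hv'1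
      -- counting: `a ~ Y v` entirely and `b ≁ Y v` entirely with `ρ a = ρ b` forces `2|Y v| ≤ |X v|`
      have count : ∀ {a b : V}, ρ a = ρ b → (∀ w, ρ' w = ρ' v → G.Adj a w) →
          (∀ w, ρ' w = ρ' v → ¬ G.Adj b w) → False := by
        intro a b hab ha hb
        have hcnt := hρ a b hab (ρ v)
        rw [natCard_subtype, natCard_subtype] at hcnt
        have h₁ : (Y v).card ≤ (univ.filter fun z => G.Adj a z ∧ ρ z = ρ v).card :=
          card_le_card fun w hw => by
            simp only [hYdef, mem_filter, mem_univ, true_and] at hw ⊢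
            exact ⟨ha w hw, href _ _ hw⟩
        have h₂ : (univ.filter fun z => G.Adj b z ∧ ρ z = ρ v).card ≤ (X v \ Y v).card :=
          card_le_card fun w hw => by
            simp only [hYdef, hXdef, mem_filter, mem_univ, true_and, mem_sdiff] at hw ⊢
            exact ⟨hw.2, fun hw' => hb w hw' hw.1⟩
        rw [card_sdiff_of_subset (hYX v)] at h₂
        have h₃ := hcon' v hv1
        have h₄ := card_le_card (hYX v)
        omega
      -- the singletons `u`, `u'` are uniformly (non)adjacent to the cell `Y v = Y v'`
      have unif_u : ∀ w, ρ' w = ρ' v → (G.Adj u w ↔ G.Adj u v) := fun w hw =>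
        hρ'.adj_iff_of_singleton huZ.1 hw
      have unif_u' : ∀ w, ρ' w = ρ' v → (G.Adj u' w ↔ G.Adj u' v') := fun w hw =>
        hρ'.adj_iff_of_singleton hu'Z.1 (hw.trans hρ'vv')
      by_contra hne
      by_cases h₁ : G.Adj u v
      · have h₂ : ¬ G.Adj u' v' := fun h₂ => hne (iff_of_true h₁ h₂)
        exact count hu (fun w hw => (unif_u w hw).2 h₁) (fun w hw h' => h₂ ((unif_u' w hw).1 h'))
      · have h₂ : G.Adj u' v' := by
          by_contra h₂
          exact hne (iff_of_false h₁ h₂)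
        exact count hu.symm (fun w hw => (unif_u' w hw).2 h₂) (fun w hw h' => h₁ ((unif_u w hw).1 h'))
    · -- `v` is a `ρ`-singleton: `v' = v`, and equitability of `ρ` at the cell `{v}` decides
      have hbig' : ∀ y, y ≠ v → ρ y ≠ ρ v := fun y hy hρy => hbig ⟨y, hy, hρy⟩
      have hv'v : v' = v := by
        by_contra h
        exact hbig' v' h hv.symm
      rw [hv'v]
      have hcnt := hρ u u' hu (ρ v)
      rw [natCard_subtype, natCard_subtype] at hcnt
      have hset : ∀ a : V, (univ.filter fun z => G.Adj a z ∧ ρ z = ρ v) = if G.Adj a v then {v} else ∅ := by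
        intro a
        ext z
        simp only [mem_filter, mem_univ, true_and]
        constructor
        · rintro ⟨haz, hz⟩
          have : z = v := by
            by_contra h
            exact hbig' z h hz
          subst this
          rw [if_pos haz]
          exact mem_singleton_self _
        · intro hz
          split_ifs at hz with hav
          · rw [mem_singleton] at hz
            subst hz
            exact ⟨hav, rfl⟩
          · exact absurd hz (notMem_empty _)
      rw [hset u, hset u'] at hcnt
      by_cases h₁ : G.Adj u v <;> by_cases h₂ : G.Adj u' v
      · exact iff_of_true h₁ h₂
      · rw [if_pos h₁, if_neg h₂, card_singleton, card_empty] at hcnt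
        exact absurd hcnt one_ne_zero
      · rw [if_neg h₁, if_pos h₂, card_empty, card_singleton] at hcnt
        exact absurd hcnt.symm one_ne_zero
      · exact iff_of_false h₁ h₂
  -- hence `Z` is a non-trivial section: contradiction
  refine hns ⟨Z, ⟨x, hxZ⟩, hZc, ?_⟩
  intro u u' v v' hu hv huu' hvv' hcross
  by_cases huZ : u ∈ Z
  · have hvZ : v ∉ Z := fun h => hcross (iff_of_true huZ h)
    exact key u u' v v' hu hv huZ (huu'.1 huZ) hvZ fun h => hvZ (hvv'.2 h)
  · have hvZ : v ∈ Z := by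
      by_contra h
      exact hcross (iff_of_false huZ h)
    have := key v v' u u' hv hu hvZ (hvv'.1 hvZ) huZ fun h => huZ (huu'.2 h)
    rwa [G.adj_comm v u, G.adj_comm v' u'] at this

end HalfCell

end Literature.Combinatorics.SimpleGraph
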